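import Summits.CriticalPhenomena.Ising3DConformalLimit.Theses.ReflectionTwin
import HarnessLib

/-!
# Stub `stub_mixedOfResponsePairing` (S5b″) of line `replica-mirror` (v5) for crux `ReflectionTwin.TwinTransparency`
(stmt-CriticalPhenomena-16905)

The REPLICA TWIN of `ℤ³` resamples the lower half-crystal `{h ≤ -1}` (`h z = z₀ + z₁ + z₂`) of a critical
free-box sample given the rest, and pairs OLD spins (points of `w` on/below the plane `x₀ + x₁ + x₂ = 0`, read at
`[wᵢ/δ]`) with NEW spins (points above the plane, reflected by the mirror `θ` of the plane and read in the
resampled configuration):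
`replicaBox L k old z = ⟨(∏_{old i} σ_{zᵢ}) · E_L[∏_{¬ old i} σ'_{zᵢ} | 𝓕]⟩^∅_{box 3 L; β_c(3)}`, `𝓕` = the spins
off `{h ≤ -1}`, `replicaFold δ k w = limsup_L replicaBox L k (h w ≤ 0) [fold w / δ]` (`fold v = v` below the
plane, `θ v` above); the RESPONSE PAIRING replaces the observable by the symmetric product
`E_L[∏_{old i} σ_{zᵢ} | 𝓕] · E_L[∏_{¬ old i} σ'_{zᵢ} | 𝓕]` of the two lower-half-crystal responses to the same
boundary data.

`stub_mixedOfResponsePairing` is the exact finite-volume bridge between the two: for EVERY `L, k, old, z` the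
replica box correlator IS the Gibbs average of the response pairing,
`⟨f · E[g | 𝓕]⟩ = ⟨E[f | 𝓕] · E[g | 𝓕]⟩` (`gibbsAvg_mul_condExp_eq_rp`), by the tower property of the exact
conditional resampling of the finite-volume Gibbs kernel (`gibbsAvg_condExp_eq_rp`: the classes
`{s' | s' = s off {h ≤ -1}}` partition the configuration space and the class averages integrate to the full sum,
`sum_classAvg_mul_eq_rp`) and the pull-out property (`condExp_mul_condExp_rp`: a class average is constant on
its class, `condClass_eq_of_mem_rp`). Hence the two renormalised families `ρ(δ)^k · pairing δ k w` and
`ρ(δ)^k · replicaFold δ k w` are the same function of `(δ, w)` (`Filter.limsup_congr` box by box) and the locally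
uniform convergence of the former on mixed configurations transfers verbatim to the latter
(`TendstoLocallyUniformlyOn.congr`). Pure finite-sum algebra about `PairIsing.gibbsAvg` / `PairIsing.gibbsWeight`;
no limit is taken and no correlation inequality is used.

References: S. Friedli, Y. Velenik, *Statistical Mechanics of Lattice Systems* (CUP 2017), §6.2 (consistency of
the finite-volume Gibbs kernels = the tower property; conditional expectations pull out measurable factors).
No definitions, no new named facts; six private helpers (names suffixed `_rp`, distinct from the private helpers
of `…ReplicaAllUpper.lean` / `…ReplicaAllUpperUniform.lean`).
-/

noncomputable section

namespace Summit.CriticalPhenomena.Ising3DConformalLimit.Cruxes.TwinTransparency.ReplicaMirror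

open scoped BigOperators Topology Manifold Classical MeasureTheory ProbabilityTheory Matrix InnerProductSpace ComplexConjugate ContinuousMap
open Filter Set Function TopologicalSpace MeasureTheory
open Literature.Probability.LatticeModels

/-! ## Tower and pull-out properties of the exact conditional resampling `E_c[· | σ_a, q a]` -/

/-- **Class averages integrate to the full sum.** If `C : Ω → Finset Ω` assigns to each point a class containing
it, constant along each class (`s' ∈ C s → C s' = C s`, so the classes partition `Ω` and `s' ∈ C s ↔ s ∈ C s'`),
then for positive weights `wt` the weighted sum of the class averages `(∑_{C s} g wt) / (∑_{C s} wt)` is the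
weighted sum of `g`: swap the double sum over the symmetric relation (`Finset.sum_comm'`). [folklore] -/
private theorem sum_classAvg_mul_eq_rp {Ω : Type*} [Fintype Ω] (C : Ω → Finset Ω) (hrefl : ∀ s, s ∈ C s)
    (hcls : ∀ s, ∀ s' ∈ C s, C s' = C s) (wt g : Ω → ℝ) (hwt : ∀ s, 0 < wt s) :
    ∑ s, (∑ s' ∈ C s, g s' * wt s') / (∑ s' ∈ C s, wt s') * wt s = ∑ s, g s * wt s := by
  have hsymm : ∀ s s', s' ∈ C s ↔ s ∈ C s' := fun s s' =>
    ⟨fun h => by rw [hcls s s' h]; exact hrefl s, fun h => by rw [hcls s' s h]; exact hrefl s'⟩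
  calc ∑ s, (∑ s' ∈ C s, g s' * wt s') / (∑ s' ∈ C s, wt s') * wt s
      = ∑ s, ∑ s' ∈ C s, g s' * wt s' * wt s / ∑ t ∈ C s', wt t := by
        refine Finset.sum_congr rfl fun s _ => ?_
        rw [div_mul_eq_mul_div, Finset.sum_mul, Finset.sum_div]
        exact Finset.sum_congr rfl fun s' hs' => by rw [hcls s s' hs']
    _ = ∑ s', ∑ s ∈ C s', g s' * wt s' * wt s / ∑ t ∈ C s', wt t :=
        Finset.sum_comm' fun s s' =>
          ⟨fun h => ⟨(hsymm s s').1 h.2, Finset.mem_univ _⟩, fun h => ⟨Finset.mem_univ _, (hsymm s s').2 h.1⟩⟩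
    _ = ∑ s', g s' * wt s' := by
        refine Finset.sum_congr rfl fun s' _ => ?_
        rw [← Finset.sum_div, ← Finset.mul_sum, mul_div_assoc,
          div_self (Finset.sum_pos (fun t _ => hwt t) ⟨s', hrefl s'⟩).ne', mul_one]

/-- The class `{t | ∀ a, q a → t a = s a}` of a configuration `s` (configurations agreeing with `s` on the
frozen sites `{a | q a}`) is the class of each of its members `s'`. [folklore] -/
private theorem condClass_eq_of_mem_rp {ι : Type*} [Fintype ι] [DecidableEq ι] (q : ι → Prop)
    {_ : ∀ s : SpinConfig ι, DecidablePred fun s' : SpinConfig ι => ∀ a, q a → s' a = s a} (s s' : SpinConfig ι)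
    (hs' : s' ∈ Finset.univ.filter (fun s' : SpinConfig ι => ∀ a, q a → s' a = s a)) :
    Finset.univ.filter (fun t : SpinConfig ι => ∀ a, q a → t a = s' a) =
      Finset.univ.filter (fun t : SpinConfig ι => ∀ a, q a → t a = s a) :=
  Finset.filter_congr fun t _ => forall₂_congr fun a ha => by rw [(Finset.mem_filter.1 hs').2 a ha]

/-- **Tower property of the exact conditional resampling.** For pair couplings `c` on the spins of a finite
set `ι` and a set of frozen sites `{a | q a}`: averaging `g` over the class `{s' | ∀ a, q a → s' a = s a}` of the
configuration `s` with the Boltzmann weights (the exact conditional expectation `E_c[g | σ_a, q a]` of the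
finite-volume Gibbs measure, evaluated at `s`) and then taking the Gibbs average in `s` returns the Gibbs average
of `g`: `⟨E_c[g | σ_a, q a]⟩_c = ⟨g⟩_c` (consistency of the finite-volume Gibbs kernels).
[cite: FriedliVelenik2017, §6.2] -/
private theorem gibbsAvg_condExp_eq_rp {ι : Type*} [Fintype ι] [DecidableEq ι] (c : ι → ι → ℝ) (q : ι → Prop)
    (g : SpinConfig ι → ℝ) {_ : ∀ s : SpinConfig ι, DecidablePred fun s' : SpinConfig ι => ∀ a, q a → s' a = s a} :
    PairIsing.gibbsAvg c (fun s =>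
        (∑ s' ∈ Finset.univ.filter (fun s' : SpinConfig ι => ∀ a, q a → s' a = s a),
            g s' * PairIsing.gibbsWeight c s') /
          (∑ s' ∈ Finset.univ.filter (fun s' : SpinConfig ι => ∀ a, q a → s' a = s a),
            PairIsing.gibbsWeight c s')) =
      PairIsing.gibbsAvg c g := by
  rw [PairIsing.gibbsAvg_def, PairIsing.gibbsAvg_def]
  congr 1
  exact sum_classAvg_mul_eq_rp (fun s => Finset.univ.filter fun s' : SpinConfig ι => ∀ a, q a → s' a = s a)
    (fun s => Finset.mem_filter.2 ⟨Finset.mem_univ _, fun _ _ => rfl⟩)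
    (fun s s' hs' => condClass_eq_of_mem_rp q s s' hs') _ g (PairIsing.gibbsWeight_pos c)

/-- **Pull-out property.** The conditional expectation `E_c[g | σ_a, q a]` is constant on each class, so
`E_c[f · E_c[g | σ_a, q a] | σ_a, q a](s) = E_c[f | σ_a, q a](s) · E_c[g | σ_a, q a](s)`. [cite: FriedliVelenik2017, §6.2] -/
private theorem condExp_mul_condExp_rp {ι : Type*} [Fintype ι] [DecidableEq ι] (c : ι → ι → ℝ) (q : ι → Prop)
    (f g : SpinConfig ι → ℝ) {_ : ∀ s : SpinConfig ι, DecidablePred fun s' : SpinConfig ι => ∀ a, q a → s' a = s a}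
    (s : SpinConfig ι) :
    (∑ s' ∈ Finset.univ.filter (fun s' : SpinConfig ι => ∀ a, q a → s' a = s a),
        (f s' * ((∑ t ∈ Finset.univ.filter (fun t : SpinConfig ι => ∀ a, q a → t a = s' a),
            g t * PairIsing.gibbsWeight c t) /
          (∑ t ∈ Finset.univ.filter (fun t : SpinConfig ι => ∀ a, q a → t a = s' a), PairIsing.gibbsWeight c t))) *
          PairIsing.gibbsWeight c s') /
      (∑ s' ∈ Finset.univ.filter (fun s' : SpinConfig ι => ∀ a, q a → s' a = s a), PairIsing.gibbsWeight c s') =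
    (∑ s' ∈ Finset.univ.filter (fun s' : SpinConfig ι => ∀ a, q a → s' a = s a), f s' * PairIsing.gibbsWeight c s') /
        (∑ s' ∈ Finset.univ.filter (fun s' : SpinConfig ι => ∀ a, q a → s' a = s a), PairIsing.gibbsWeight c s') *
      ((∑ s' ∈ Finset.univ.filter (fun s' : SpinConfig ι => ∀ a, q a → s' a = s a), g s' * PairIsing.gibbsWeight c s') /
        (∑ s' ∈ Finset.univ.filter (fun s' : SpinConfig ι => ∀ a, q a → s' a = s a), PairIsing.gibbsWeight c s')) := by
  rw [div_mul_eq_mul_div, Finset.sum_mul]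
  congr 1
  refine Finset.sum_congr rfl fun s' hs' => ?_
  rw [condClass_eq_of_mem_rp q s s' hs']
  ring

/-- **Self-adjointness / Markov factorisation of the resampling pairing**: `⟨f · E[g | 𝓕]⟩_c = ⟨E[f | 𝓕] · E[g | 𝓕]⟩_c`
for `𝓕 = σ(σ_a, q a)` — the tower property applied to `f · E[g | 𝓕]` (`gibbsAvg_condExp_eq_rp`), then the pull-out
property inside (`condExp_mul_condExp_rp`). [cite: FriedliVelenik2017, §6.2] -/
private theorem gibbsAvg_mul_condExp_eq_rp {ι : Type*} [Fintype ι] [DecidableEq ι] (c : ι → ι → ℝ) (q : ι → Prop)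
    (f g : SpinConfig ι → ℝ) {_ : ∀ s : SpinConfig ι, DecidablePred fun s' : SpinConfig ι => ∀ a, q a → s' a = s a} :
    PairIsing.gibbsAvg c (fun s => f s *
        ((∑ s' ∈ Finset.univ.filter (fun s' : SpinConfig ι => ∀ a, q a → s' a = s a), g s' * PairIsing.gibbsWeight c s') /
          (∑ s' ∈ Finset.univ.filter (fun s' : SpinConfig ι => ∀ a, q a → s' a = s a), PairIsing.gibbsWeight c s'))) =
      PairIsing.gibbsAvg c (fun s =>
        (∑ s' ∈ Finset.univ.filter (fun s' : SpinConfig ι => ∀ a, q a → s' a = s a), f s' * PairIsing.gibbsWeight c s') /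
            (∑ s' ∈ Finset.univ.filter (fun s' : SpinConfig ι => ∀ a, q a → s' a = s a), PairIsing.gibbsWeight c s') *
          ((∑ s' ∈ Finset.univ.filter (fun s' : SpinConfig ι => ∀ a, q a → s' a = s a), g s' * PairIsing.gibbsWeight c s') /
            (∑ s' ∈ Finset.univ.filter (fun s' : SpinConfig ι => ∀ a, q a → s' a = s a), PairIsing.gibbsWeight c s'))) := by
  rw [← gibbsAvg_condExp_eq_rp c q (fun s => f s *
        ((∑ s' ∈ Finset.univ.filter (fun s' : SpinConfig ι => ∀ a, q a → s' a = s a), g s' * PairIsing.gibbsWeight c s') /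
          (∑ s' ∈ Finset.univ.filter (fun s' : SpinConfig ι => ∀ a, q a → s' a = s a), PairIsing.gibbsWeight c s')))]
  congr 1
  funext s
  exact condExp_mul_condExp_rp c q f g s

/-! ## The factorisation of the replica box correlator -/

/-- **Factorisation of the replica box correlator as the response pairing.** For the free nearest-neighbour
critical box `box 3 L` of `ℤ³`, every `k`, every marking `old` of the indices and every `z : Fin k → Site 3`:
`⟨(∏_{old i} σ_{zᵢ}) · E_L[∏_{¬ old i} σ'_{zᵢ} | 𝓕]⟩^∅_{box L; β_c(3)} = ⟨m_old · m_new⟩^∅_{box L; β_c(3)}` with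
`m_old = E_L[∏_{old i} σ_{zᵢ} | 𝓕]`, `m_new = E_L[∏_{¬ old i} σ_{zᵢ} | 𝓕]`, `𝓕` = the spins off the lower
half-crystal `{h ≤ -1}` (instance of `gibbsAvg_mul_condExp_eq_rp`; both sides are written with the verbatim
sub-terms of the registered signature). [cite: FriedliVelenik2017, §6.2] -/
private theorem replicaBox_eq_pairing_rp (L k : ℕ) (old : Fin k → Prop) (z : Fin k → Site 3) :
    PairIsing.gibbsAvg (fun a b : ↥(box 3 L) => if (∑ i, |a.1 i - b.1 i| = 1) then criticalBeta 3 / 2 else (0:ℝ))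
        (fun s => (∏ i, if old i then (if h : z i ∈ box 3 L then spinAt (⟨z i, h⟩ : ↥(box 3 L)) s else 0) else 1) *
          ((∑ s' ∈ Finset.univ.filter (fun s' : SpinConfig ↥(box 3 L) =>
                ∀ a : ↥(box 3 L), ¬ (a.1 0 + a.1 1 + a.1 2 ≤ -1) → s' a = s a),
              (∏ i, if old i then 1 else (if h : z i ∈ box 3 L then spinAt (⟨z i, h⟩ : ↥(box 3 L)) s' else 0)) *
                PairIsing.gibbsWeight
                  (fun a b : ↥(box 3 L) => if (∑ i, |a.1 i - b.1 i| = 1) then criticalBeta 3 / 2 else (0:ℝ)) s') /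
            (∑ s' ∈ Finset.univ.filter (fun s' : SpinConfig ↥(box 3 L) =>
                ∀ a : ↥(box 3 L), ¬ (a.1 0 + a.1 1 + a.1 2 ≤ -1) → s' a = s a),
              PairIsing.gibbsWeight
                (fun a b : ↥(box 3 L) => if (∑ i, |a.1 i - b.1 i| = 1) then criticalBeta 3 / 2 else (0:ℝ)) s'))) =
      PairIsing.gibbsAvg (fun a b : ↥(box 3 L) => if (∑ i, |a.1 i - b.1 i| = 1) then criticalBeta 3 / 2 else (0:ℝ))
        (fun s =>
          (∑ s' ∈ Finset.univ.filter (fun s' : SpinConfig ↥(box 3 L) =>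
                ∀ a : ↥(box 3 L), ¬ (a.1 0 + a.1 1 + a.1 2 ≤ -1) → s' a = s a),
              (∏ i, if old i then (if h : z i ∈ box 3 L then spinAt (⟨z i, h⟩ : ↥(box 3 L)) s' else 0) else 1) *
                PairIsing.gibbsWeight
                  (fun a b : ↥(box 3 L) => if (∑ i, |a.1 i - b.1 i| = 1) then criticalBeta 3 / 2 else (0:ℝ)) s') /
              (∑ s' ∈ Finset.univ.filter (fun s' : SpinConfig ↥(box 3 L) =>
                  ∀ a : ↥(box 3 L), ¬ (a.1 0 + a.1 1 + a.1 2 ≤ -1) → s' a = s a),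
                PairIsing.gibbsWeight
                  (fun a b : ↥(box 3 L) => if (∑ i, |a.1 i - b.1 i| = 1) then criticalBeta 3 / 2 else (0:ℝ)) s') *
            ((∑ s' ∈ Finset.univ.filter (fun s' : SpinConfig ↥(box 3 L) =>
                  ∀ a : ↥(box 3 L), ¬ (a.1 0 + a.1 1 + a.1 2 ≤ -1) → s' a = s a),
                (∏ i, if old i then 1 else (if h : z i ∈ box 3 L then spinAt (⟨z i, h⟩ : ↥(box 3 L)) s' else 0)) *
                  PairIsing.gibbsWeight
                    (fun a b : ↥(box 3 L) => if (∑ i, |a.1 i - b.1 i| = 1) then criticalBeta 3 / 2 else (0:ℝ)) s') /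
              (∑ s' ∈ Finset.univ.filter (fun s' : SpinConfig ↥(box 3 L) =>
                  ∀ a : ↥(box 3 L), ¬ (a.1 0 + a.1 1 + a.1 2 ≤ -1) → s' a = s a),
                PairIsing.gibbsWeight
                  (fun a b : ↥(box 3 L) => if (∑ i, |a.1 i - b.1 i| = 1) then criticalBeta 3 / 2 else (0:ℝ)) s'))) :=
  gibbsAvg_mul_condExp_eq_rp _ _
    (fun s => ∏ i, if old i then (if h : z i ∈ box 3 L then spinAt (⟨z i, h⟩ : ↥(box 3 L)) s else 0) else 1)
    (fun s' => ∏ i, if old i then 1 else (if h : z i ∈ box 3 L then spinAt (⟨z i, h⟩ : ↥(box 3 L)) s' else 0))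

/-! ## The stub -/

/-- **stub_mixedOfResponsePairing (S5b″ — the MIXED replica mirror follows from the response-pairing form).**
For every `L, k, old, z` the replica box correlator factorises EXACTLY as the Gibbs average of the product of the
two exact conditional expectations given the spins off `{h ≤ -1}`,
`⟨(∏_{old} σ) · E[∏_{new} σ | 𝓕]⟩ = ⟨E[∏_{old} σ | 𝓕] · E[∏_{new} σ | 𝓕]⟩` (`replicaBox_eq_pairing_rp`: tower
property + pull-out for the finite-volume Gibbs kernel — the class average is constant on classes and the classes
partition the configuration space), so under the `limsup` over boxes (`Filter.limsup_congr`) the two renormalised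
families `ρ(δ)^k · pairing δ k w` and `ρ(δ)^k · replicaFold δ k w` are the same function of `(δ, w)` and the locally
uniform statements coincide (`TendstoLocallyUniformlyOn.congr`). [cite: FriedliVelenik2017, §6.2] -/
theorem stub_mixedOfResponsePairing :
    (fun (replicaFold : ℝ → (k : ℕ) → (Fin k → EuclideanSpace ℝ (Fin 3)) → ℝ) (pairing : ℝ → (k : ℕ) → (Fin k → EuclideanSpace ℝ (Fin 3)) → ℝ) => (∀ (ρ : ℝ → ℝ) (S : CorrFamily 3), (∀ δ ∈ Set.Ioc (0:ℝ) 1, 0 < ρ δ) → HasPointwiseScalingLimit (criticalCorr 3) ρ S → IsNondegenerateTwoPoint S → ∀ (k : ℕ), Even k → TendstoLocallyUniformlyOn (fun (δ : ℝ) (w : Fin k → EuclideanSpace ℝ (Fin 3)) => ρ δ ^ k * pairing δ k w) (S k) (𝓝[>] (0:ℝ)) (NonCoincident 3 k ∩ {w | ∀ i, w i 0 + w i 1 + w i 2 ≠ 0} ∩ {w | (∃ i, 0 < w i 0 + w i 1 + w i 2) ∧ (∃ i, w i 0 + w i 1 + w i 2 < 0)})) → (∀ (ρ : ℝ → ℝ)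 (S : CorrFamily 3), (∀ δ ∈ Set.Ioc (0:ℝ) 1, 0 < ρ δ) → HasPointwiseScalingLimit (criticalCorr 3) ρ S → IsNondegenerateTwoPoint S → ∀ (k : ℕ), Even k → TendstoLocallyUniformlyOn (fun (δ : ℝ) (w : Fin k → EuclideanSpace ℝ (Fin 3)) => ρ δ ^ k * replicaFold δ k w) (S k) (𝓝[>] (0:ℝ)) (NonCoincident 3 k ∩ {w | ∀ i, w i 0 + w i 1 + w i 2 ≠ 0} ∩ {w | (∃ i, 0 < w i 0 + w i 1 + w i 2) ∧ (∃ i, w i 0 + w i 1 + w i 2 < 0)}))) (fun (δ : ℝ) (k : ℕ) (w : Fin k → EuclideanSpace ℝ (Fin 3)) => Filter.limsup (fun L : ℕ => (fun (L k : ℕ) (old : Fin k → Prop) (z : Fin k → Site 3) => PairIsing.gibbsAvg (fun a b : ↥(box 3 L) => if (∑ i, |a.1 i - b.1 i| = 1) then criticalBeta 3 / 2 else (0:ℝ)) (fun s => (∏ i, if old i then (if h : z i ∈ box 3 L then spinAt (⟨z i, h⟩ : ↥(box 3 L)) s else 0) else 1) * (fun (g : SpinConfig ↥(box 3 L) → ℝ)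 (s : SpinConfig ↥(box 3 L)) => (∑ s' ∈ Finset.univ.filter (fun s' : SpinConfig ↥(box 3 L) => ∀ a : ↥(box 3 L), ¬ (a.1 0 + a.1 1 + a.1 2 ≤ -1) → s' a = s a), g s' * PairIsing.gibbsWeight (fun a b : ↥(box 3 L) => if (∑ i, |a.1 i - b.1 i| = 1) then criticalBeta 3 / 2 else (0:ℝ)) s') / (∑ s' ∈ Finset.univ.filter (fun s' : SpinConfig ↥(box 3 L) => ∀ a : ↥(box 3 L), ¬ (a.1 0 + a.1 1 + a.1 2 ≤ -1) → s' a = s a), PairIsing.gibbsWeight (fun a b : ↥(box 3 L) => if (∑ i, |a.1 i - b.1 i| = 1) then criticalBeta 3 / 2 else (0:ℝ)) s')) (fun s' => ∏ i, if old i then 1 else (if h : z i ∈ box 3 L then spinAt (⟨z i, h⟩ : ↥(box 3 L)) s' else 0)) s)) L k (fun i => w i 0 + w i 1 + w i 2 ≤ 0) (fun i => latticeApprox δ ((fun v : EuclideanSpace ℝ (Fin 3) => if v 0 + v 1 + v 2 ≤ 0 then v else (fun v : EuclideanSpace ℝ (Fin 3) => ((ℝ ∙ (EuclideanSpace.single 0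 1 + EuclideanSpace.single 1 1 + EuclideanSpace.single 2 1 : EuclideanSpace ℝ (Fin 3)))ᗮ).reflection v) v) (w i)))) Filter.atTop) (fun (δ : ℝ) (k : ℕ) (w : Fin k → EuclideanSpace ℝ (Fin 3)) => Filter.limsup (fun L : ℕ => (fun (L k : ℕ) (old : Fin k → Prop) (z : Fin k → Site 3) => PairIsing.gibbsAvg (fun a b : ↥(box 3 L) => if (∑ i, |a.1 i - b.1 i| = 1) then criticalBeta 3 / 2 else (0:ℝ)) (fun s => (fun (g : SpinConfig ↥(box 3 L) → ℝ) (s : SpinConfig ↥(box 3 L)) => (∑ s' ∈ Finset.univ.filter (fun s' : SpinConfig ↥(box 3 L) => ∀ a : ↥(box 3 L), ¬ (a.1 0 + a.1 1 + a.1 2 ≤ -1) → s' a = s a), g s' * PairIsing.gibbsWeight (fun a b : ↥(box 3 L) => if (∑ i, |a.1 i - b.1 i| = 1) then criticalBeta 3 / 2 else (0:ℝ)) s') / (∑ s' ∈ Finset.univ.filter (fun s' : SpinConfig ↥(box 3 L) => ∀ a : ↥(box 3 L), ¬ (a.1 0 + a.1 1 + a.1 2 ≤ -1) → s' a = s a),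 PairIsing.gibbsWeight (fun a b : ↥(box 3 L) => if (∑ i, |a.1 i - b.1 i| = 1) then criticalBeta 3 / 2 else (0:ℝ)) s')) (fun s' => ∏ i, if old i then (if h : z i ∈ box 3 L then spinAt (⟨z i, h⟩ : ↥(box 3 L)) s' else 0) else 1) s * (fun (g : SpinConfig ↥(box 3 L) → ℝ) (s : SpinConfig ↥(box 3 L)) => (∑ s' ∈ Finset.univ.filter (fun s' : SpinConfig ↥(box 3 L) => ∀ a : ↥(box 3 L), ¬ (a.1 0 + a.1 1 + a.1 2 ≤ -1) → s' a = s a), g s' * PairIsing.gibbsWeight (fun a b : ↥(box 3 L) => if (∑ i, |a.1 i - b.1 i| = 1) then criticalBeta 3 / 2 else (0:ℝ)) s') / (∑ s' ∈ Finset.univ.filter (fun s' : SpinConfig ↥(box 3 L) => ∀ a : ↥(box 3 L), ¬ (a.1 0 + a.1 1 + a.1 2 ≤ -1) → s' a = s a), PairIsing.gibbsWeight (fun a b : ↥(box 3 L) => if (∑ i, |a.1 i - b.1 i| = 1) then criticalBeta 3 / 2 else (0:ℝ)) s')) (fun s' => ∏ i, if old i then 1 else (if h : z i ∈ box 3 L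 then spinAt (⟨z i, h⟩ : ↥(box 3 L)) s' else 0)) s)) L k (fun i => w i 0 + w i 1 + w i 2 ≤ 0) (fun i => latticeApprox δ ((fun v : EuclideanSpace ℝ (Fin 3) => if v 0 + v 1 + v 2 ≤ 0 then v else (fun v : EuclideanSpace ℝ (Fin 3) => ((ℝ ∙ (EuclideanSpace.single 0 1 + EuclideanSpace.single 1 1 + EuclideanSpace.single 2 1 : EuclideanSpace ℝ (Fin 3)))ᗮ).reflection v) v) (w i)))) Filter.atTop) := by
  intro hP ρ S hρ hlim hnd k hk
  refine (hP ρ S hρ hlim hnd k hk).congr fun δ w _ => ?_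
  -- for every `δ, w` the two renormalised functions agree: expose the box averages under the `limsup` …
  beta_reduce
  refine congrArg (fun t => ρ δ ^ k * t) (limsup_congr (Eventually.of_forall fun L => ?_))
  -- … where, box by box, the response pairing IS the replica box correlator
  exact (replicaBox_eq_pairing_rp L k _ _).symm

end Summit.CriticalPhenomena.Ising3DConformalLimit.Cruxes.TwinTransparency.ReplicaMirror

end
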